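import Literature.NumberTheory.GaloisRepresentations.LubinTateColemanRelativeTraceTwo
import Literature.NumberTheory.GaloisRepresentations.LubinTateColemanTraceTwo
import HarnessLib

/-!
# `q = 2`: Coleman's lemma, the rank-two decomposition `𝒪_E⟦X⟧ = 𝒪_E⟦f⟧ ⊕ X·𝒪_E⟦f⟧`, and
# `ker 𝒮_E = (1 + (2/π)X)·𝒪_E⟦f⟧`, `im 𝒮_E = π·𝒪_E⟦X⟧` — with coefficients in `𝒪_E` for every finite `E ⊇ F`

De Shalit, *Iwasawa theory of elliptic curves with complex multiplication* (1987), Ch. I §3.3 (7), Thm. 3.7, §3.8,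
§3.12; Ch. III §1.3: the units half of the structure theorem over an extended (unramified) base.  For `f = πX + X²`
over `F` with `|𝓀_F| = 2`, `E ⊇ F` finite, `τ_E`, `𝒮_E` as in `LubinTateColemanRelativeTraceTwo.lean`:

* `isClosed_span_singleton_of_ne_zero`, `isClosed_span_algebraMap_pi` (non-zero principal ideals of `𝒪_E` are closed) and ★ `reflE_sub_self_mem_span` — **`τ_E G ≡ G (mod π)`**;
* ★ `exists_subst_eq_of_reflE_eq` / `exists_subst_eq_iff_reflE_eq` — **Coleman's lemma in `𝒪_E⟦X⟧`**: `Q = R ∘ f`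
  for some `R ∈ 𝒪_E⟦X⟧` iff `τ_E Q = Q`;
* ★★ `exists_eq_subst_add_X_mul_subst_E`, `subst_add_X_mul_subst_injective_E` — **every `G ∈ 𝒪_E⟦X⟧` is uniquely
  `R₀ ∘ f + X·(R₁ ∘ f)`** (`G − τ_E G = πD`, `2 = πt`, `Q₁ = D/(1 + tX)` and `G − XQ₁` are `τ_E`-invariant);
* ★★★ `relTraceTwo_eq_zero_iff`, `eq_of_one_add_mul_subst_eq_E` — **`𝒮_E G = 0 ⟺ G = (1 + tX)·(R ∘ f)`, `R` unique**:
  the trace-zero series over `𝒪_E` are free of rank one over `𝒪_E⟦Y⟧`; `exists_relTraceTwo_eq_C_mul`,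
  `relTraceTwo_neg_X_mul_subst` — **`im 𝒮_E = π·𝒪_E⟦X⟧`**;
* `reflE_map`, ★ `relTraceTwo_map`, `relNormTwo_map` — **`τ_E`, `𝒮_E`, `𝒩_E` extend `reflTwo`, `𝒮`, `𝒩` of
  `𝒪[F]⟦X⟧`** (compatibility with `colemanTrace`/`colemanNorm` along `ι : 𝒪[F] → 𝒪_E`).

This is de Shalit's (7) and the cokernel-free part of I.3.7 with coefficients in `𝒪_E` (`E = k'` unramified: the
local input of III.1.3 at `p = 2`); the `φ`-twisted interpolation of the norm-coherent units of `k'·K_π^n` is the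
sequel.  0 sorry, no named facts.

## References

* E. de Shalit, *Iwasawa theory of elliptic curves with complex multiplication* (1987), Ch. I §3.3 (7), §3.7, §3.8,
  §3.12; Ch. III §1.3. [deShalit1987]
-/

noncomputable section

open scoped PowerSeries.WithPiTopology

namespace Literature.NumberTheory.GaloisRepresentations
section LocalFieldRel2c

open GaloisRepresentations.IsNonarchimedeanLocalField LubinTate ValuativeRel

variable (F : Type*) [Field F] [ValuativeRel F] [TopologicalSpace F] [IsNonarchimedeanLocalField F]

attribute [local instance] ltNormUniformSpace ltNormIsUniformAddGroup rk1 nF nE fintypeResidueField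

variable {F}
variable {π : 𝒪[F]} (hπ : (valuation F).IsUniformizer (π : F))
variable (E : IntermediateField F (AlgebraicClosure F)) [FiniteDimensional F E]

/-- `f` is substitutable (`f(0) = 0`). [folklore] -/
private theorem hasSubst_mapLtSer₃ :
    PowerSeries.HasSubst ((ltSer F π).map (algebraMap (LTCoeff F) (unitBall E))) :=
  PowerSeries.HasSubst.of_constantCoeff_zero' ((isLTSeries_ltSer π).map _).constantCoeff_eq_zero

/-! ### `τ_E G ≡ G (mod π)`: the principal ideal `(π) ⊆ 𝒪_E` is closed -/

/-- **Non-zero principal ideals of `𝒪_E` are closed**: `(s)` contains the open ball of radius `‖s‖`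
(`‖x‖ < ‖s‖ ⟹ x/s ∈ 𝒪_E`), so it is an open, hence closed, additive subgroup. [cite: deShalit1987, Ch. I §2.1] -/
theorem isClosed_span_singleton_of_ne_zero {s : unitBall E} (hs : s ≠ 0) :
    IsClosed ((Ideal.span {s} : Ideal (unitBall E)) : Set (unitBall E)) := by
  have hs0 : ((s : unitBall E) : E) ≠ 0 := fun h0 => hs (Subtype.ext h0)
  have hnorm : 0 < ‖((s : unitBall E) : E)‖ := norm_pos_iff.mpr hs0
  have hball : Metric.ball (0 : unitBall E) ‖((s : unitBall E) : E)‖ ⊆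
      ((Ideal.span {s} : Ideal (unitBall E)) : Set (unitBall E)) := by
    intro x hx
    rw [Metric.mem_ball, dist_zero_right] at hx
    change ‖((x : unitBall E) : E)‖ < _ at hx
    have hy : (x : E) / (s : E) ∈ unitBall E := by
      rw [mem_unitBall_iff, norm_div, div_le_one hnorm]
      exact hx.le
    refine Ideal.mem_span_singleton'.mpr ⟨⟨_, hy⟩, Subtype.ext ?_⟩
    change (x : E) / (s : E) * (s : E) = (x : E)
    rw [div_mul_cancel₀ _ hs0]
  have hopen : IsOpen (((Ideal.span {s} : Ideal (unitBall E)) : Set (unitBall E))) :=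
    (Ideal.span {s}).toAddSubgroup.isOpen_of_mem_nhds
      (Filter.mem_of_superset (Metric.ball_mem_nhds (0 : unitBall E) hnorm) hball)
  exact (Ideal.span {s}).toAddSubgroup.isClosed_of_isOpen hopen

include hπ in
/-- **`(π)·𝒪_E` is closed.** [cite: deShalit1987, Ch. I §2.1] -/
theorem isClosed_span_algebraMap_pi :
    IsClosed ((Ideal.span {algebraMap 𝒪[F] (unitBall E) π} : Ideal (unitBall E)) : Set (unitBall E)) :=
  isClosed_span_singleton_of_ne_zero E (algebraMap_pi_ne_zero hπ E)

/-- ★ **`τ_E G ≡ G (mod π)`** for every `G ∈ 𝒪_E⟦X⟧` (`q = 2`): `X [+] ω₁ − X = −2X − π ∈ (π)` as `2 = πt`.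
[cite: deShalit1987, Ch. I §3.12] -/
theorem reflE_sub_self_mem_span (hq : residueFieldCard F = 2) (G : PowerSeries (unitBall E)) :
    reflE hπ E G - G ∈ coeffIdeal (Ideal.span {algebraMap 𝒪[F] (unitBall E) π}) := by
  obtain ⟨t, ht⟩ := exists_two_eq_pi_mul hπ hq
  refine evT_sub_self_mem_coeffIdeal _ _ (isClosed_span_algebraMap_pi hπ E) _ ?_ G
  rw [coe_tPt_divPtTwo hπ E hq one_ne_zero]
  intro k
  have e : -PowerSeries.X - PowerSeries.C (algebraMap 𝒪[F] (unitBall E) π) - (PowerSeries.X : PowerSeries (unitBall E)) =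
      PowerSeries.C (algebraMap 𝒪[F] (unitBall E) π) *
        (-(PowerSeries.C (algebraMap (LTCoeff F) (unitBall E) t) * PowerSeries.X) - 1) := by
    have h2' : algebraMap 𝒪[F] (unitBall E) π * algebraMap (LTCoeff F) (unitBall E) t = 2 := by
      change algebraMap (LTCoeff F) (unitBall E) (LTCoeff.of F π) * algebraMap (LTCoeff F) (unitBall E) t = 2
      rw [← map_mul, ← ht, map_ofNat]
    have h2 : (2 : PowerSeries (unitBall E)) =
        PowerSeries.C (algebraMap 𝒪[F] (unitBall E) π) * PowerSeries.C (algebraMap (LTCoeff F) (unitBall E) t) := by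
      rw [← map_mul, h2', map_ofNat]
    linear_combination (-PowerSeries.X : PowerSeries (unitBall E)) * h2
  rw [e, PowerSeries.coeff_C_mul]
  exact Ideal.mul_mem_right _ _ (Ideal.mem_span_singleton_self _)

/-! ### Coleman's lemma in `𝒪_E⟦X⟧` and the rank-two decomposition over `𝒪_E` -/

/-- ★ **Coleman's lemma in `𝒪_E⟦X⟧`** (`q = 2`): a reflection-invariant series is `R ∘ f` with `R ∈ 𝒪_E⟦X⟧` — the
`f`-adic expansion, no descent. [cite: deShalit1987, Ch. I §3.12] -/
theorem exists_subst_eq_of_reflE_eq (hq : residueFieldCard F = 2) {Q : PowerSeries (unitBall E)}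
    (hQ : reflE hπ E Q = Q) :
    ∃ R : PowerSeries (unitBall E), PowerSeries.subst ((ltSer F π).map (algebraMap (LTCoeff F) (unitBall E))) R = Q := by
  have hQ' : ∀ c : 𝓀[F], evT (maxNilIdeal F E) (tPt (maxNilIdeal F E) (isLTRing_LTCoeff hπ) (isLTSeries_LTCoeff π)
      (divPtTwo hπ E c)) Q = Q := fun c => by
    rcases eq_zero_or_eq_one_two hq c with rfl | rfl
    · rw [divPtTwo_zero, tPt, serC_zero, ltAdd_zero, evT_serX_apply]
    · exact hQ
  exact ⟨invSer (isColemanFamily_divPtTwo hπ E hq) Q hQ', subst_invSer _ _ _⟩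

/-- `Q = R ∘ f` for some `R` iff `Q` is reflection invariant. [cite: deShalit1987, Ch. I §3.12] -/
theorem exists_subst_eq_iff_reflE_eq (hq : residueFieldCard F = 2) (Q : PowerSeries (unitBall E)) :
    (∃ R : PowerSeries (unitBall E), PowerSeries.subst ((ltSer F π).map (algebraMap (LTCoeff F) (unitBall E))) R = Q) ↔
      reflE hπ E Q = Q :=
  ⟨fun ⟨R, hR⟩ => by rw [← hR, reflE_subst hπ E hq], exists_subst_eq_of_reflE_eq hπ E hq⟩

/-- `τ_E (C π + 2X) = −(C π + 2X)`. [cite: deShalit1987, Ch. I §3.12] -/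
theorem reflE_C_add_two_mul_X (hq : residueFieldCard F = 2) :
    reflE hπ E (PowerSeries.C (algebraMap 𝒪[F] (unitBall E) π) + 2 * PowerSeries.X) =
      -(PowerSeries.C (algebraMap 𝒪[F] (unitBall E) π) + 2 * PowerSeries.X) := by
  rw [map_add, map_mul, reflE_C, reflE_X hπ E hq, show (2 : PowerSeries (unitBall E)) = PowerSeries.C 2 by
    rw [map_ofNat], reflE_C, map_ofNat]
  ring

include hπ in
/-- `C π + 2X ≠ 0` in `𝒪_E⟦X⟧`. [folklore] -/
private theorem C_add_two_mul_X_ne_zero_E :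
    PowerSeries.C (algebraMap 𝒪[F] (unitBall E) π) + 2 * PowerSeries.X ≠ (0 : PowerSeries (unitBall E)) := by
  intro h0
  have h1 := congrArg PowerSeries.constantCoeff h0
  rw [map_add, map_mul, PowerSeries.constantCoeff_C, PowerSeries.constantCoeff_X, mul_zero, add_zero, map_zero] at h1
  exact algebraMap_pi_ne_zero hπ E h1

include hπ in
/-- **Uniqueness of the decomposition over `𝒪_E`.** [cite: deShalit1987, Ch. I §3.12] -/
theorem subst_add_X_mul_subst_injective_E (hq : residueFieldCard F = 2) {R₀ R₁ R₀' R₁' : PowerSeries (unitBall E)}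
    (h : PowerSeries.subst ((ltSer F π).map (algebraMap (LTCoeff F) (unitBall E))) R₀ +
        PowerSeries.X * PowerSeries.subst ((ltSer F π).map (algebraMap (LTCoeff F) (unitBall E))) R₁ =
      PowerSeries.subst ((ltSer F π).map (algebraMap (LTCoeff F) (unitBall E))) R₀' +
        PowerSeries.X * PowerSeries.subst ((ltSer F π).map (algebraMap (LTCoeff F) (unitBall E))) R₁') :
    R₀ = R₀' ∧ R₁ = R₁' := by
  have h' := congrArg (reflE hπ E) h
  rw [map_add, map_add, map_mul, map_mul, reflE_X hπ E hq, reflE_subst hπ E hq, reflE_subst hπ E hq,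
    reflE_subst hπ E hq, reflE_subst hπ E hq] at h'
  have h1 : (PowerSeries.C (algebraMap 𝒪[F] (unitBall E) π) + 2 * PowerSeries.X) *
      (PowerSeries.subst ((ltSer F π).map (algebraMap (LTCoeff F) (unitBall E))) R₁ -
        PowerSeries.subst ((ltSer F π).map (algebraMap (LTCoeff F) (unitBall E))) R₁') = 0 := by
    linear_combination h - h'
  rcases mul_eq_zero.mp h1 with h2 | h2
  · exact absurd h2 (C_add_two_mul_X_ne_zero_E hπ E)
  · have hR₁ : R₁ = R₁' := subst_map_ltSer_injective hπ E (sub_eq_zero.mp h2)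
    subst hR₁
    exact ⟨subst_map_ltSer_injective hπ E (add_right_cancel h), rfl⟩

include hπ in
/-- ★★ **The rank-two decomposition over `𝒪_E`**: every `G ∈ 𝒪_E⟦X⟧` is `R₀ ∘ f + X·(R₁ ∘ f)` with
`R₀, R₁ ∈ 𝒪_E⟦X⟧` (`G − τ_E G = πD`, `Q₁ = D/(1 + tX)` and `G − XQ₁` are reflection invariant).
[cite: deShalit1987, Ch. I §3.12] -/
theorem exists_eq_subst_add_X_mul_subst_E (hq : residueFieldCard F = 2) (G : PowerSeries (unitBall E)) :
    ∃ R₀ R₁ : PowerSeries (unitBall E),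
      G = PowerSeries.subst ((ltSer F π).map (algebraMap (LTCoeff F) (unitBall E))) R₀ +
        PowerSeries.X * PowerSeries.subst ((ltSer F π).map (algebraMap (LTCoeff F) (unitBall E))) R₁ := by
  set p : unitBall E := algebraMap 𝒪[F] (unitBall E) π with hp
  obtain ⟨t, ht⟩ := exists_two_eq_pi_mul hπ hq
  set tE : unitBall E := algebraMap (LTCoeff F) (unitBall E) t with htE
  have h2' : p * tE = 2 := by
    rw [hp, htE]
    change algebraMap (LTCoeff F) (unitBall E) (LTCoeff.of F π) * algebraMap (LTCoeff F) (unitBall E) t = 2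
    rw [← map_mul, ← ht, map_ofNat]
  have h2 : (2 : PowerSeries (unitBall E)) = PowerSeries.C p * PowerSeries.C tE := by
    rw [← map_mul, h2', map_ofNat]
  obtain ⟨D, hD⟩ := exists_eq_C_mul_of_mem_coeffIdeal_span (Submodule.neg_mem _ (reflE_sub_self_mem_span hπ E hq G))
  rw [neg_sub] at hD
  set w : PowerSeries (unitBall E) := 1 + PowerSeries.C tE * PowerSeries.X with hw
  have hwu : IsUnit w := by
    rw [PowerSeries.isUnit_iff_constantCoeff, hw, map_add, map_one, map_mul, PowerSeries.constantCoeff_X, mul_zero,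
      add_zero]
    exact isUnit_one
  have hπw : PowerSeries.C p * w = PowerSeries.C p + 2 * PowerSeries.X := by rw [hw, h2]; ring
  set Q₁ : PowerSeries (unitBall E) := D * ↑hwu.unit⁻¹ with hQ₁
  have hQ₁e : (PowerSeries.C p + 2 * PowerSeries.X) * Q₁ = G - reflE hπ E G := by
    rw [← hπw, hQ₁, mul_assoc, mul_left_comm w, IsUnit.mul_val_inv, mul_one, hD]
  have hQ₁r : reflE hπ E Q₁ = Q₁ := by
    have h1 := congrArg (reflE hπ E) hQ₁e
    rw [map_mul, reflE_C_add_two_mul_X hπ E hq, map_sub, reflE_reflE hπ E hq] at h1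
    have h3 : (PowerSeries.C p + 2 * PowerSeries.X) * (reflE hπ E Q₁ - Q₁) = 0 := by
      linear_combination -hQ₁e - h1
    rcases mul_eq_zero.mp h3 with h4 | h4
    · exact absurd h4 (C_add_two_mul_X_ne_zero_E hπ E)
    · exact sub_eq_zero.mp h4
  obtain ⟨R₁, hR₁⟩ := exists_subst_eq_of_reflE_eq hπ E hq hQ₁r
  have hR₀r : reflE hπ E (G - PowerSeries.X * Q₁) = G - PowerSeries.X * Q₁ := by
    rw [map_sub, map_mul, reflE_X hπ E hq, hQ₁r]
    linear_combination hQ₁e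
  obtain ⟨R₀, hR₀⟩ := exists_subst_eq_of_reflE_eq hπ E hq hR₀r
  exact ⟨R₀, R₁, by rw [hR₀, hR₁]; ring⟩

/-! ### `ker 𝒮_E = (1 + tX)·𝒪_E⟦f⟧` and `im 𝒮_E = π·𝒪_E⟦X⟧` -/

/-- ★★★ **`ker 𝒮_E = (1 + tX)·𝒪_E⟦f⟧`** (`2 = πt`): for `G ∈ 𝒪_E⟦X⟧`, `𝒮_E G = 0` iff `G = (1 + tX)·(R ∘ f)` for some
`R ∈ 𝒪_E⟦X⟧` — the trace-zero series over `𝒪_E` form a free `𝒪_E⟦Y⟧`-module of rank one (de Shalit's (7) / the units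
half of I.3.7 with coefficients in `𝒪_E`, e.g. `E = k'` unramified). [cite: deShalit1987, Ch. I §3.3 (7), §3.7] -/
theorem relTraceTwo_eq_zero_iff (hq : residueFieldCard F = 2) {t : LTCoeff F} (ht : (2 : LTCoeff F) = LTCoeff.of F π * t)
    (G : PowerSeries (unitBall E)) :
    relTraceTwo hπ E hq G = 0 ↔ ∃ R : PowerSeries (unitBall E),
      G = (1 + PowerSeries.C (algebraMap (LTCoeff F) (unitBall E) t) * PowerSeries.X) *
        PowerSeries.subst ((ltSer F π).map (algebraMap (LTCoeff F) (unitBall E))) R := by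
  set p : unitBall E := algebraMap 𝒪[F] (unitBall E) π with hp
  set tE : unitBall E := algebraMap (LTCoeff F) (unitBall E) t with htE
  have h2 : (PowerSeries.C 2 : PowerSeries (unitBall E)) = PowerSeries.C p * PowerSeries.C tE := by
    rw [← map_mul, hp, htE]
    change _ = PowerSeries.C (algebraMap (LTCoeff F) (unitBall E) (LTCoeff.of F π) * algebraMap (LTCoeff F) (unitBall E) t)
    rw [← map_mul, ← ht, map_ofNat (algebraMap (LTCoeff F) (unitBall E)) 2]
  have key : ∀ R : PowerSeries (unitBall E), (1 + PowerSeries.C tE * PowerSeries.X) *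
      PowerSeries.subst ((ltSer F π).map (algebraMap (LTCoeff F) (unitBall E))) R =
      PowerSeries.subst ((ltSer F π).map (algebraMap (LTCoeff F) (unitBall E))) R + PowerSeries.X *
        PowerSeries.subst ((ltSer F π).map (algebraMap (LTCoeff F) (unitBall E))) (PowerSeries.C tE * R) := by
    intro R
    rw [← PowerSeries.coe_substAlgHom (hasSubst_mapLtSer₃ E), map_mul, PowerSeries.coe_substAlgHom,
      PowerSeries.C_eq_algebraMap, ← PowerSeries.coe_substAlgHom (hasSubst_mapLtSer₃ E), AlgHom.commutes,
      PowerSeries.coe_substAlgHom, ← PowerSeries.C_eq_algebraMap]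
    ring
  constructor
  · intro h0
    obtain ⟨R₀, R₁, hG⟩ := exists_eq_subst_add_X_mul_subst_E hπ E hq G
    rw [hG, relTraceTwo_subst_add_X_mul_subst hπ E hq, h2, mul_assoc, ← mul_sub, mul_eq_zero] at h0
    rcases h0 with h0 | h0
    · have h00 := congrArg PowerSeries.constantCoeff h0
      rw [PowerSeries.constantCoeff_C, map_zero] at h00
      exact absurd h00 (algebraMap_pi_ne_zero hπ E)
    · refine ⟨R₀, ?_⟩
      rw [key, sub_eq_zero.mp h0]
      exact hG
  · rintro ⟨R, rfl⟩
    rw [key, relTraceTwo_subst_add_X_mul_subst hπ E hq, h2]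
    ring

include hπ in
/-- … with `R` unique. [cite: deShalit1987, Ch. I §3.3 (7), §3.7] -/
theorem eq_of_one_add_mul_subst_eq_E (hq : residueFieldCard F = 2) (s : unitBall E) {R R' : PowerSeries (unitBall E)}
    (h : (1 + PowerSeries.C s * PowerSeries.X) * PowerSeries.subst ((ltSer F π).map (algebraMap (LTCoeff F) (unitBall E))) R =
      (1 + PowerSeries.C s * PowerSeries.X) * PowerSeries.subst ((ltSer F π).map (algebraMap (LTCoeff F) (unitBall E))) R') :
    R = R' := by
  have key : ∀ R : PowerSeries (unitBall E), (1 + PowerSeries.C s * PowerSeries.X) *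
      PowerSeries.subst ((ltSer F π).map (algebraMap (LTCoeff F) (unitBall E))) R =
      PowerSeries.subst ((ltSer F π).map (algebraMap (LTCoeff F) (unitBall E))) R + PowerSeries.X *
        PowerSeries.subst ((ltSer F π).map (algebraMap (LTCoeff F) (unitBall E))) (PowerSeries.C s * R) := by
    intro R
    rw [← PowerSeries.coe_substAlgHom (hasSubst_mapLtSer₃ E), map_mul, PowerSeries.coe_substAlgHom,
      PowerSeries.C_eq_algebraMap, ← PowerSeries.coe_substAlgHom (hasSubst_mapLtSer₃ E), AlgHom.commutes,
      PowerSeries.coe_substAlgHom, ← PowerSeries.C_eq_algebraMap]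
    ring
  rw [key, key] at h
  exact (subst_add_X_mul_subst_injective_E hπ E hq h).1

/-- ★★ **`im 𝒮_E ⊆ π·𝒪_E⟦X⟧`**: every `𝒮_E G` is divisible by `π`. [cite: deShalit1987, Ch. I §3.12] -/
theorem exists_relTraceTwo_eq_C_mul (hq : residueFieldCard F = 2) (G : PowerSeries (unitBall E)) :
    ∃ G' : PowerSeries (unitBall E), relTraceTwo hπ E hq G = PowerSeries.C (algebraMap 𝒪[F] (unitBall E) π) * G' := by
  obtain ⟨t, ht⟩ := exists_two_eq_pi_mul hπ hq
  have h2 : (PowerSeries.C 2 : PowerSeries (unitBall E)) =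
      PowerSeries.C (algebraMap 𝒪[F] (unitBall E) π) * PowerSeries.C (algebraMap (LTCoeff F) (unitBall E) t) := by
    rw [← map_mul]
    change _ = PowerSeries.C (algebraMap (LTCoeff F) (unitBall E) (LTCoeff.of F π) * algebraMap (LTCoeff F) (unitBall E) t)
    rw [← map_mul, ← ht, map_ofNat (algebraMap (LTCoeff F) (unitBall E)) 2]
  obtain ⟨R₀, R₁, hG⟩ := exists_eq_subst_add_X_mul_subst_E hπ E hq G
  refine ⟨PowerSeries.C (algebraMap (LTCoeff F) (unitBall E) t) * R₀ - R₁, ?_⟩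
  rw [hG, relTraceTwo_subst_add_X_mul_subst hπ E hq, h2]
  ring

/-- ★★ **`π·𝒪_E⟦X⟧ ⊆ im 𝒮_E`**: `π G' = 𝒮_E(−X · (G' ∘ f))`. [cite: deShalit1987, Ch. I §3.12] -/
theorem relTraceTwo_neg_X_mul_subst (hq : residueFieldCard F = 2) (G' : PowerSeries (unitBall E)) :
    relTraceTwo hπ E hq (-PowerSeries.X * PowerSeries.subst ((ltSer F π).map (algebraMap (LTCoeff F) (unitBall E))) G') =
      PowerSeries.C (algebraMap 𝒪[F] (unitBall E) π) * G' := by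
  have h := relTraceTwo_subst_add_X_mul_subst hπ E hq 0 (-G')
  rw [← PowerSeries.coe_substAlgHom (hasSubst_mapLtSer₃ E), map_zero, map_neg, PowerSeries.coe_substAlgHom, zero_add,
    mul_zero, zero_sub, mul_neg, mul_neg, neg_neg] at h
  rw [neg_mul, h]

end LocalFieldRel2c

section LocalFieldRel2d

open GaloisRepresentations.IsNonarchimedeanLocalField LubinTate ValuativeRel

variable (F : Type*) [Field F] [ValuativeRel F] [TopologicalSpace F] [IsNonarchimedeanLocalField F]

attribute [local instance] ltNormUniformSpace ltNormIsUniformAddGroup rk1 nF nE fintypeResidueField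

variable {F}
variable {π : 𝒪[F]} (hπ : (valuation F).IsUniformizer (π : F)) (n : ℕ)
variable (E : IntermediateField F (AlgebraicClosure F)) [FiniteDimensional F E]

/-! ### Compatibility with the operators on `𝒪[F]⟦X⟧` -/

/-- `ι (r ∘ f) = (ι r) ∘ f`. [folklore] -/
private theorem map_subst_ltSer (r : PowerSeries (LTCoeff F)) :
    PowerSeries.map (algebraMap (LTCoeff F) (unitBall E)) (PowerSeries.subst (ltSer F π) r) =
      PowerSeries.subst ((ltSer F π).map (algebraMap (LTCoeff F) (unitBall E)))
        (r.map (algebraMap (LTCoeff F) (unitBall E))) :=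
  PowerSeries.map_subst (PowerSeries.HasSubst.of_constantCoeff_zero' (isLTSeries_ltSer π).constantCoeff_eq_zero) _

/-- ★ **`τ_E (ι h) = ι (h(−π − X))`**: the reflection of `𝒪_E⟦X⟧` extends the reflection `reflTwo` of `𝒪[F]⟦X⟧`
(both fix `𝒪⟦f⟧` and send `X ↦ −π − X`; use `h = r₀ ∘ f + X·(r₁ ∘ f)`). [cite: deShalit1987, Ch. I §3.12] -/
theorem reflE_map (hq : residueFieldCard F = 2) (h : PowerSeries (LTCoeff F)) :
    reflE hπ E (h.map (algebraMap (LTCoeff F) (unitBall E))) =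
      (reflTwo hπ n h).map (algebraMap (LTCoeff F) (unitBall E)) := by
  obtain ⟨r₀, r₁, hh⟩ := exists_eq_subst_add_X_mul_subst_two hπ hq h
  have e1 : h.map (algebraMap (LTCoeff F) (unitBall E)) =
      PowerSeries.subst ((ltSer F π).map (algebraMap (LTCoeff F) (unitBall E)))
          (r₀.map (algebraMap (LTCoeff F) (unitBall E))) +
        PowerSeries.X * PowerSeries.subst ((ltSer F π).map (algebraMap (LTCoeff F) (unitBall E)))
          (r₁.map (algebraMap (LTCoeff F) (unitBall E))) := by
    rw [hh, map_add, map_mul, PowerSeries.map_X, map_subst_ltSer, map_subst_ltSer]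
  have e2 : (reflTwo hπ n h).map (algebraMap (LTCoeff F) (unitBall E)) =
      PowerSeries.subst ((ltSer F π).map (algebraMap (LTCoeff F) (unitBall E)))
          (r₀.map (algebraMap (LTCoeff F) (unitBall E))) +
        (-PowerSeries.X - PowerSeries.C (algebraMap (LTCoeff F) (unitBall E) (LTCoeff.of F π))) *
          PowerSeries.subst ((ltSer F π).map (algebraMap (LTCoeff F) (unitBall E)))
            (r₁.map (algebraMap (LTCoeff F) (unitBall E))) := by
    rw [hh, reflTwo_add hπ n hq, reflTwo_mul hπ n hq, reflTwo_X hπ n hq, reflTwo_subst_ltSer hπ n hq,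
      reflTwo_subst_ltSer hπ n hq, map_add, map_mul, map_sub, map_neg, PowerSeries.map_X, PowerSeries.map_C,
      map_subst_ltSer, map_subst_ltSer]
  rw [e1, e2, map_add, map_mul, reflE_X hπ E hq, reflE_subst hπ E hq, reflE_subst hπ E hq]
  rfl

/-- ★ **`𝒮_E (ι h) = ι (𝒮 h)`**: Coleman's trace operator on `𝒪_E⟦X⟧` extends the one on `𝒪[F]⟦X⟧`.
[cite: deShalit1987, Ch. I §3.12] -/
theorem relTraceTwo_map (hq : residueFieldCard F = 2) (h : PowerSeries (LTCoeff F)) :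
    relTraceTwo hπ E hq (h.map (algebraMap (LTCoeff F) (unitBall E))) =
      (colemanTrace hπ n h).map (algebraMap (LTCoeff F) (unitBall E)) := by
  refine subst_map_ltSer_injective hπ E ?_
  change PowerSeries.subst _ _ = PowerSeries.subst _ _
  rw [subst_relTraceTwo, ← map_subst_ltSer, subst_colemanTrace_two hπ n hq, map_add, reflE_map hπ n E hq]

/-- ★ **`𝒩_E (ι h) = ι (𝒩 h)`**: Coleman's norm operator on `𝒪_E⟦X⟧` extends the one on `𝒪[F]⟦X⟧`
(`(𝒩h) ∘ f = h · h(−π − X)` at `q = 2`). [cite: deShalit1987, Ch. I §2.1] -/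
theorem relNormTwo_map (hq : residueFieldCard F = 2) (h : PowerSeries (LTCoeff F)) :
    relNormTwo hπ E hq (h.map (algebraMap (LTCoeff F) (unitBall E))) =
      (colemanNorm hπ n h).map (algebraMap (LTCoeff F) (unitBall E)) := by
  refine subst_map_ltSer_injective hπ E ?_
  change PowerSeries.subst _ _ = PowerSeries.subst _ _
  have hN : PowerSeries.map (algebraMap (LTCoeff F) (unitBall (ltField π n)))
      (PowerSeries.subst (ltSer F π) (colemanNorm hπ n h)) =
      PowerSeries.map (algebraMap (LTCoeff F) (unitBall (ltField π n))) (h * reflTwo hπ n h) := by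
    rw [map_subst_colemanNorm, nProd, Fintype.prod_eq_mul 0 1 zero_ne_one
      (fun c hc => absurd (eq_zero_or_eq_one_two hq c) (not_or.mpr hc)), map_mul, transl_ltDivPt_zero,
      map_reflTwo hπ n hq]
  have hN' : PowerSeries.subst (ltSer F π) (colemanNorm hπ n h) = h * reflTwo hπ n h :=
    PowerSeries.map_injective _ (algebraMap_LTCoeff_injective (ltField π n)) hN
  rw [subst_relNormTwo, ← map_subst_ltSer, hN', map_mul, reflE_map hπ n E hq]

end LocalFieldRel2d

end Literature.NumberTheory.GaloisRepresentations
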